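import Literature.Topology.FourManifolds.SeifertSurfaceOrientation
import Literature.Topology.FourManifolds.SeifertCircleMapProofs
import Literature.Topology.FourManifolds.SurfaceGenusParityProofs
import Literature.Topology.FourManifolds.SliceGenusProofs
import Literature.Analysis.Calculus.SardProofs
import HarnessLib

/-!
# Seifert's theorem, proved (discharge of `Knot.exists_hasSeifertSurfaceOfGenus`)

Sibling proof file of `Literature/Topology/FourManifolds/SliceGenus.lean` for its named fact
`Literature.Topology.FourManifolds.Knot.exists_hasSeifertSurfaceOfGenus` — **every knot bounds a
Seifert surface**: for every smooth knot `K : 𝕊¹ ↪ 𝕊³` there is a `g : ℕ` and a compact connected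
orientable smooth surface `S` with one boundary circle, smoothly embedded in `𝕊³ ⊆ ℝ⁴` with
boundary `K` and `rank H₁(S; ℤ) = 2g` (H. Seifert, *Über das Geschlecht von Knoten*, Math. Ann.
110 (1934/35) — the paper introducing Seifert surfaces and the genus of a knot; textbook forms:
Rolfsen, *Knots and Links*, §5.A.4; Cromwell, *Knots and Links* (2004), Thm. 5.1.1; Juhász (2023),
Prop. 4.10).

Seifert's own proof is the diagrammatic *Seifert algorithm*.  The tree proves the theorem along
the transversality route of Juhász, *Differential and Low-Dimensional Topology* (2023),
Prop. 4.10 (PDF pp. 109–110): a `0`-framed tubular neighbourhood `ν` of `K`, a smooth circle map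
`θ : 𝕊³ ∖ K → 𝕊¹` which is the angular coordinate on the punctured tube, a regular value `v` of
`θ` (Sard), the level surface `θ⁻¹(v) ∪ K` — a compact orientable surface in `𝕊³` bounded by the
knot — and its component containing the knot; the genus is read off from `rank H₁ = 2g`, which
needs the parity of the first Betti number of a compact orientable surface with one boundary
circle.  That pipeline is assembled, with its three analytic/topological inputs as hypotheses, in
`Knot.exists_hasSeifertSurfaceOfGenus_of_facts` (`SeifertSurfaceOrientation.lean`, on top of
`SeifertCircleMap.lean`, `CircleMapRegularValues.lean`, `SeifertLevelSurface.lean`,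
`SeifertSurfaceClosure.lean`, `SeifertSurfaceExistence.lean`).  All three inputs are now theorems
of the tree:

* `Knot.exists_circleMap_eq_angle_of_hasFraming_zero_holds` (`SeifertCircleMapProofs.lean`) — the
  circle-valued map of a `0`-framed knot exterior (Juhász 2023, proof of Prop. 4.10, first half);
* `Literature.Analysis.Calculus.sard_holds` (`Analysis/Calculus/SardProofs.lean`) — Sard's theorem;
* `even_finrank_singularHomology_one_of_boundary_circle_holds` (`SurfaceGenusParityProofs.lean`) —
  `rank H₁(S; ℤ)` is even for a compact connected orientable surface with `∂S ≅ 𝕊¹` (Hirsch,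
  *Differential Topology*, Ch. 9 §3, Thm. 3.7).

This file feeds them in (`Knot.exists_hasSeifertSurfaceOfGenus_holds`) and records the resulting
unconditional forms of the `SliceGenus.lean` API that took the fact as hypothesis `hS`: the
Seifert genus and the slice genus are attained, every knot bounds a slice surface, and
`g₄(K) ≤ g(K)` (the push-in fact being the theorem
`Knot.HasSeifertSurfaceOfGenus.hasSliceSurfaceOfGenus_holds` of `SliceGenusProofs.lean`).
No definitions and no named facts are introduced.

## References

* H. Seifert, *Über das Geschlecht von Knoten*, Math. Ann. 110 (1935), 571–592 (received 1934;
  doi:10.1007/BF01448044). [Seifert1934]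
* A. Juhász, *Differential and Low-Dimensional Topology*, LMS Student Texts 104, CUP (2023),
  Prop. 4.10 (PDF pp. 109–110). [Juhasz2023]
* M. W. Hirsch, *Differential Topology*, GTM 33 (1976), Ch. 9 §3, Thm. 3.7. [HirschDT1976]
* C. Livingston, *A survey of classical knot concordance*, Handbook of Knot Theory (2005), §9.1,
  §9.5 (`g₄ ≤ g`). [Livingston2005]
-/

noncomputable section

namespace Literature.Topology.FourManifolds

/-! ### The discharge -/

/-- **Seifert's theorem: every knot bounds a Seifert surface** (discharge of the named fact
`Literature.Topology.FourManifolds.Knot.exists_hasSeifertSurfaceOfGenus` of `SliceGenus.lean`):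
for every smooth knot `K` in `𝕊³` there are `g : ℕ` and a compact connected orientable smooth
surface with one boundary circle, smoothly embedded in `𝕊³` with boundary `K` and
`rank H₁ = 2g`.  Proof: the transversality construction of Juhász 2023, Prop. 4.10, assembled in
`Knot.exists_hasSeifertSurfaceOfGenus_of_facts` and fed with the tree's theorems
`Knot.exists_circleMap_eq_angle_of_hasFraming_zero_holds` (circle map of the `0`-framed knot
exterior), `Literature.Analysis.Calculus.sard_holds` (Sard) and
`even_finrank_singularHomology_one_of_boundary_circle_holds` (parity of `b₁`).
[cite: Seifert1934] [cite: Juhasz2023, Prop. 4.10 (PDF pp. 109–110)] -/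
theorem Knot.exists_hasSeifertSurfaceOfGenus_holds : Knot.exists_hasSeifertSurfaceOfGenus :=
  Knot.exists_hasSeifertSurfaceOfGenus_of_facts Knot.exists_circleMap_eq_angle_of_hasFraming_zero_holds
    Literature.Analysis.Calculus.sard_holds even_finrank_singularHomology_one_of_boundary_circle_holds

/-! ### Unconditional forms of the `SliceGenus.lean` API -/

namespace Knot

/-- **The Seifert genus is attained**: every knot `K` bounds a Seifert surface of genus `g(K)`
(`Knot.hasSeifertSurfaceOfGenus_genus` fed with Seifert's theorem
`Knot.exists_hasSeifertSurfaceOfGenus_holds`). [folklore] -/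
theorem hasSeifertSurfaceOfGenus_genus' (K : Knot) : K.HasSeifertSurfaceOfGenus K.genus :=
  hasSeifertSurfaceOfGenus_genus exists_hasSeifertSurfaceOfGenus_holds K

/-- **Every knot bounds a slice surface of some genus** (Seifert's theorem
`Knot.exists_hasSeifertSurfaceOfGenus_holds` and the push into `B⁴`,
`Knot.HasSeifertSurfaceOfGenus.hasSliceSurfaceOfGenus_holds`). [cite: Livingston2005, §9.1] -/
theorem exists_hasSliceSurfaceOfGenus' (K : Knot) : ∃ g, K.HasSliceSurfaceOfGenus g :=
  exists_hasSliceSurfaceOfGenus exists_hasSeifertSurfaceOfGenus_holds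
    HasSeifertSurfaceOfGenus.hasSliceSurfaceOfGenus_holds K

/-- **The slice genus is attained**: every knot `K` bounds a slice surface of genus `g₄(K)`.
[folklore] -/
theorem hasSliceSurfaceOfGenus_sliceGenus' (K : Knot) : K.HasSliceSurfaceOfGenus K.sliceGenus :=
  hasSliceSurfaceOfGenus_sliceGenus exists_hasSeifertSurfaceOfGenus_holds
    HasSeifertSurfaceOfGenus.hasSliceSurfaceOfGenus_holds K

/-- **`g₄(K) ≤ g(K)`** for every knot `K`: a minimal-genus Seifert surface pushed into `B⁴` is a
slice surface (`Knot.sliceGenus_le_genus` fed with `Knot.exists_hasSeifertSurfaceOfGenus_holds` and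
`Knot.HasSeifertSurfaceOfGenus.hasSliceSurfaceOfGenus_holds`). [cite: Livingston2005, §9.5] -/
theorem sliceGenus_le_genus' (K : Knot) : K.sliceGenus ≤ K.genus :=
  sliceGenus_le_genus exists_hasSeifertSurfaceOfGenus_holds
    HasSeifertSurfaceOfGenus.hasSliceSurfaceOfGenus_holds K

end Knot

end Literature.Topology.FourManifolds
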